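import Mathlib.FieldTheory.Finite.GaloisField
import Mathlib.FieldTheory.Finiteness
import Mathlib.LinearAlgebra.FiniteDimensional.Lemmas
import Mathlib.Algebra.Module.Projective
import Literature.InformationTheory.QuantumCodes.StabilizerDistance
import Literature.InformationTheory.QuantumCodes.ParityCheckDuality
import HarnessLib

/-!
# Steane's enlargement of CSS codes (Steane 1999, Theorem 1)

Topic `Literature/InformationTheory/QuantumCodes` (LADDER-QEC, LIT-1 custody: code families with PROVED
parameters). Everything here is PROVED (no named facts).

**Source.** A. M. Steane, *Enlargement of Calderbank–Shor–Steane quantum codes*, IEEE Trans. Inform.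
Theory 45 (1999), no. 7, 2492–2495 = arXiv:quant-ph/9802061 [Steane1999] (held text, §2, chunk p0004):

> **Theorem 1.** Given a classical binary error correcting code `C = [n,k,d]` which contains its dual,
> `C⊥ ⊆ C`, and which can be enlarged to `C' = [n, k' > k+1, d']`, a pure quantum code of parameters
> `[[n, k + k' − n, min(d, ⌈3d'/2⌉)]]` can be constructed.

Printed proof (ibid.): the generator of the quantum code is `𝒢 = (D | AD; G | 0; 0 | G)` where `G`
generates `C`, `G` and `D` together generate `C'`, and `A` is an invertible FIXED-POINT-FREE linear
map on the `D`-part ("we choose `A` such that `D` and `AD` generate the same set … such that `u = v`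
never occurs"); the stabilizer is its symplectic dual, commutative because `C⊥ ⊆ C`; `#rows(𝒢) = k + k'`
gives dimension `k + k' − n`; and a nonzero `(u|v) ∈ 𝒢` has `wt ≥ d` unless `wt u, wt v < d`, in
which case `u, v, u+v` are nonzero words of `C'`, so `wt(u|v) = (wt u + wt v + wt(u+v))/2 ≥ 3d'/2`.

**What is typed** (tree vocabulary of `SymplecticCodes.lean`: `Ē = SympVec n`, `S̄⊥ = sympDual`,
`PureAdditiveCodeExists`; classical codes are `Submodule (ZMod 2) (Fin n → ZMod 2)` with
`Coding.dualCode`). Steane's matrix `A` on the complement `D` of `C` in `C'` is rendered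
basis-free as a linear map `ψ` of the quotient `𝔽₂ⁿ/C` that preserves `C'/C`, is injective on it and
has no nonzero fixed point there; the generator space is
`steaneSpace C C' ψ = {(u|v) : u, v ∈ C', [v] = ψ[u] in 𝔽₂ⁿ/C}` (for `ψ = A ⊕ …` this is exactly
the row space of `𝒢`).

* `sympDual_steaneSpace_le` — `𝒢⊥ ≤ 𝒢` (the stabilizer `𝒢⊥` is self-orthogonal), from `C⊥ ≤ C`;
* `card_steaneSpace`, `finrank_steaneSpace` — `|𝒢| = |C'|·|C|`, `dim 𝒢 = k' + k` ("the number of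
  rows in the generator is `k + k'`");
* `two_mul_sympWeight` — `2·wt(u|v) = wt u + wt v + wt(u+v)`; `le_sympWeight_of_mem_steaneSpace` —
  every nonzero `(u|v) ∈ 𝒢` has `wt(u|v) ≥ min(d, ⌈3d'/2⌉)` (the heart of the printed proof);
* `exists_steaneMap` — for `dim C' ≥ dim C + 2` a map `ψ` as above exists (Steane's explicit matrix
  `A`; here: transport of multiplication by an `α ∉ {0,1}` of `GF(2^m)`, `m = k' − k ≥ 2`);
* **`Steane1999_theorem1`** — Theorem 1 as printed: `C⊥ ≤ C ≤ C'`, `dim C = k`, `dim C' = k' ≥ k + 2`,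
  `wt(C ∖ 0) ≥ d`, `wt(C' ∖ 0) ≥ d'` ⇒ `PureAdditiveCodeExists n (k + k' − n) (min d ⌈3d'/2⌉)`
  (`⌈3d'/2⌉ = (3d' + 1)/2` in `ℕ`).

Scope / honesty notes. Binary codes only (as in the paper). The BCH examples of §3 and the table of
§4 are not typed (they need BCH minimum distances). The hypothesis `k' > k + 1` is needed exactly for
the existence of a fixed-point-free invertible `A` (`GL_1(𝔽₂) = {1}`).

## Tree / Mathlib search

`rg -i enlargement`, `rg 9802061|Steane1999` over `Literature/InformationTheory` (2026-08-27): no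
prior formalisation; CSS codes (`cssSpace`, `CRSS1998_theorem9_css_holds`), self-orthogonality and
the `[[n,k,d]]` predicates are reused from `SymplecticCodes.lean`; `hammingNorm_fst_le_sympWeight`
from `StabilizerDistance.lean`; `finrank_dualCode` from `ParityCheckDuality.lean`; `GaloisField`,
`LinearEquiv.ofFinrankEq`, `Submodule.projectionOnto` from Mathlib.
-/

namespace Literature.InformationTheory.QuantumCodes

open Finset Module Coding

variable {n : ℕ}

/-! ### 1. The generator space `𝒢` -/

/-- **Steane's generator space** `𝒢 = {(u|v) : u, v ∈ C', v ≡ ψ(u) mod C}` — the row space of the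
printed generator `(D | AD; G | 0; 0 | G)` when `ψ` is the map induced by `A` on `C'/C`
(extended by anything on a complement). [cite: Steane1999, §2 Thm. 1 proof (arXiv:quant-ph/9802061 chunk p0004: "The generator for the quantum code is 𝒢 = (D AD; G 0; 0 G)")] -/
def steaneSpace (C C' : Submodule (ZMod 2) (Fin n → ZMod 2))
    (ψ : ((Fin n → ZMod 2) ⧸ C) →ₗ[ZMod 2] ((Fin n → ZMod 2) ⧸ C)) :
    Submodule (ZMod 2) (SympVec n) where
  carrier := {w | w.1 ∈ C' ∧ w.2 ∈ C' ∧ C.mkQ w.2 = ψ (C.mkQ w.1)}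
  add_mem' := by
    rintro a b ⟨ha1, ha2, ha3⟩ ⟨hb1, hb2, hb3⟩
    refine ⟨C'.add_mem ha1 hb1, C'.add_mem ha2 hb2, ?_⟩
    change C.mkQ (a.2 + b.2) = ψ (C.mkQ (a.1 + b.1))
    rw [map_add, map_add, map_add, ha3, hb3]
  zero_mem' := by
    refine ⟨C'.zero_mem, C'.zero_mem, ?_⟩
    change C.mkQ 0 = ψ (C.mkQ 0)
    simp only [map_zero]
  smul_mem' := by
    rintro c a ⟨ha1, ha2, ha3⟩
    refine ⟨C'.smul_mem c ha1, C'.smul_mem c ha2, ?_⟩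
    change C.mkQ (c • a.2) = ψ (C.mkQ (c • a.1))
    rw [map_smul, map_smul, map_smul, ha3]

variable {C C' : Submodule (ZMod 2) (Fin n → ZMod 2)}
  {ψ : ((Fin n → ZMod 2) ⧸ C) →ₗ[ZMod 2] ((Fin n → ZMod 2) ⧸ C)}

/-- Membership in `𝒢`. [cite: Steane1999, §2 Thm. 1 proof (chunk p0004)] -/
theorem mem_steaneSpace_iff {w : SympVec n} :
    w ∈ steaneSpace C C' ψ ↔ w.1 ∈ C' ∧ w.2 ∈ C' ∧ C.mkQ w.2 = ψ (C.mkQ w.1) :=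
  Iff.rfl

/-- `[x] = 0` in `𝔽₂ⁿ/C` for `x ∈ C`. [folklore] -/
private theorem mkQ_eq_zero_of_mem {x : Fin n → ZMod 2} (hx : x ∈ C) : C.mkQ x = 0 :=
  (Submodule.Quotient.mk_eq_zero C).2 hx

/-- `[x] = 0` in `𝔽₂ⁿ/C` only for `x ∈ C`. [folklore] -/
private theorem mem_of_mkQ_eq_zero {x : Fin n → ZMod 2} (hx : C.mkQ x = 0) : x ∈ C :=
  (Submodule.Quotient.mk_eq_zero C).1 hx

/-! ### 2. The stabilizer `𝒢⊥` is self-orthogonal -/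

/-- **`𝒢⊥ ≤ 𝒢`**: the stabilizer `ℋ = 𝒢⊥` satisfies the commutativity condition, because
`C⊥ ⊆ C` ("From the dual conditions specified in the theorem, `H'H'ᵀ = 0` and `H'Bᵀ = 0` so the
commutativity condition is satisfied"): indeed `(0|c), (c|0) ∈ 𝒢` for `c ∈ C` force both halves of a
vector of `𝒢⊥` into `C⊥ ≤ C`, and `C × C ≤ 𝒢`.
[cite: Steane1999, §2 Thm. 1 proof (chunk p0004: "so the commutativity condition (comm) is satisified")] -/
theorem sympDual_steaneSpace_le (hdual : dualCode C ≤ C) (hCC' : C ≤ C') :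
    sympDual (steaneSpace C C' ψ) ≤ steaneSpace C C' ψ := by
  intro w hw
  rw [mem_sympDual_iff] at hw
  have h1 : w.1 ∈ C := by
    refine hdual (mem_dualCode_iff.2 fun c hc => ?_)
    have hmem : ((0 : Fin n → ZMod 2), c) ∈ steaneSpace C C' ψ :=
      ⟨C'.zero_mem, hCC' hc, show C.mkQ c = ψ (C.mkQ 0) by
        rw [map_zero, map_zero, mkQ_eq_zero_of_mem hc]⟩
    have := hw _ hmem
    rw [sympInner, zero_dotProduct, zero_add] at this
    rwa [dotProduct_comm]
  have h2 : w.2 ∈ C := by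
    refine hdual (mem_dualCode_iff.2 fun c hc => ?_)
    have hmem : (c, (0 : Fin n → ZMod 2)) ∈ steaneSpace C C' ψ :=
      ⟨hCC' hc, C'.zero_mem, show C.mkQ 0 = ψ (C.mkQ c) by
        rw [map_zero, mkQ_eq_zero_of_mem hc, map_zero]⟩
    have := hw _ hmem
    rwa [sympInner, dotProduct_zero, add_zero] at this
  exact ⟨hCC' h1, hCC' h2, by rw [mkQ_eq_zero_of_mem h1, mkQ_eq_zero_of_mem h2, map_zero]⟩

/-! ### 3. `dim 𝒢 = k + k'` -/

section Count

open scoped Classical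

/-- `|C| = 2^{dim C}` as a filtered count. [folklore] -/
private theorem card_filter_mem_code (C : Submodule (ZMod 2) (Fin n → ZMod 2)) :
    #{v : Fin n → ZMod 2 | v ∈ C} = 2 ^ finrank (ZMod 2) C := by
  rw [← Fintype.card_subtype, Module.card_eq_pow_finrank (K := ZMod 2) (V := C), ZMod.card]

/-- **`|𝒢| = |C'|·|C|`**: for each `u ∈ C'` the admissible `v` form one coset `y + C` (`[y] = ψ[u]`,
`y ∈ C'` because `ψ` preserves `C'/C`). [cite: Steane1999, §2 Thm. 1 proof (chunk p0004: "Since the number of rows in the generator is k + k'")] -/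
theorem card_steaneSpace (hCC' : C ≤ C') (hψ : ∀ x ∈ C'.map C.mkQ, ψ x ∈ C'.map C.mkQ) :
    Fintype.card (steaneSpace C C' ψ) = 2 ^ finrank (ZMod 2) C' * 2 ^ finrank (ZMod 2) C := by
  rw [Fintype.card_subtype]
  have hsplit : #{w : SympVec n | w ∈ steaneSpace C C' ψ} =
      ∑ u : Fin n → ZMod 2, ∑ v : Fin n → ZMod 2,
        if (u, v) ∈ steaneSpace C C' ψ then 1 else 0 := by
    rw [Finset.card_filter, Fintype.sum_prod_type]
  have inner : ∀ u : Fin n → ZMod 2,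
      (∑ v : Fin n → ZMod 2, if (u, v) ∈ steaneSpace C C' ψ then 1 else 0) =
        if u ∈ C' then 2 ^ finrank (ZMod 2) C else 0 := by
    intro u
    by_cases hu : u ∈ C'
    · rw [if_pos hu]
      obtain ⟨y, hy, hyu⟩ := Submodule.mem_map.1 (hψ _ (Submodule.mem_map.2 ⟨u, hu, rfl⟩))
      have hiff : ∀ v : Fin n → ZMod 2, (u, v) ∈ steaneSpace C C' ψ ↔ v - y ∈ C := by
        intro v
        rw [mem_steaneSpace_iff]
        change u ∈ C' ∧ v ∈ C' ∧ C.mkQ v = ψ (C.mkQ u) ↔ v - y ∈ C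
        rw [← hyu]
        constructor
        · rintro ⟨-, -, h⟩
          exact (Submodule.Quotient.eq C).1 h
        · intro h
          refine ⟨hu, ?_, (Submodule.Quotient.eq C).2 h⟩
          have : v = (v - y) + y := by abel
          rw [this]
          exact C'.add_mem (hCC' h) hy
      rw [← card_filter_mem_code C, Finset.card_filter]
      refine Fintype.sum_equiv (Equiv.subRight y) _ _ fun v => ?_
      rw [Equiv.subRight_apply]
      exact if_congr (hiff v) rfl rfl
    · rw [if_neg hu]
      exact Finset.sum_eq_zero fun v _ => if_neg fun h => hu h.1
  rw [hsplit, Finset.sum_congr rfl fun u _ => inner u, Finset.sum_ite, Finset.sum_const_zero,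
    add_zero, Finset.sum_const, smul_eq_mul, card_filter_mem_code, mul_comm]

/-- **`dim 𝒢 = k' + k`** ("the number of rows in the generator is `k + k'`").
[cite: Steane1999, §2 Thm. 1 proof (chunk p0004: "Since the number of rows in the generator is k + k', the dimension of the quantum code is k + k' − n")] -/
theorem finrank_steaneSpace (hCC' : C ≤ C') (hψ : ∀ x ∈ C'.map C.mkQ, ψ x ∈ C'.map C.mkQ) :
    finrank (ZMod 2) (steaneSpace C C' ψ) = finrank (ZMod 2) C' + finrank (ZMod 2) C := by
  have h := Module.card_eq_pow_finrank (K := ZMod 2) (V := steaneSpace C C' ψ)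
  rw [ZMod.card, card_steaneSpace hCC' hψ, ← pow_add] at h
  exact (Nat.pow_right_injective (le_refl 2) h).symm

end Count

/-! ### 4. Weights in `𝒢` -/

/-- One coordinate of `2·wt(u|v) = wt u + wt v + wt(u+v)` over `𝔽₂`. [folklore] -/
private theorem two_mul_ite_or (a b : ZMod 2) :
    (2 * if a ≠ 0 ∨ b ≠ 0 then 1 else 0 : ℕ) =
      ((if a ≠ 0 then 1 else 0) + if b ≠ 0 then 1 else 0) + if a + b ≠ 0 then 1 else 0 := by
  revert a b; decide

/-- `2·wt(u|v) = wt u + wt v + wt(u+v)` ("if `u` and `v` overlap in `p` places, then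
`wt(u+v) = wt(u) − p + wt(v) − p` and `wt(u|v) = wt(u) + wt(v) − p`").
[cite: Steane1999, §2 Thm. 1 proof (chunk p0004: "wt(u|v) = wt(u) + wt(v) − p = (wt(u) + wt(v) + wt(u+v))/2")] -/
theorem two_mul_sympWeight (w : SympVec n) :
    2 * sympWeight w = hammingNorm w.1 + hammingNorm w.2 + hammingNorm (w.1 + w.2) := by
  simp only [sympWeight, hammingNorm, Finset.card_filter, Finset.mul_sum, ← Finset.sum_add_distrib]
  refine Finset.sum_congr rfl fun i _ => ?_
  beta_reduce
  rw [Pi.add_apply]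
  exact two_mul_ite_or (w.1 i) (w.2 i)

/-- In an `𝔽₂`-space, `a + b = 0` means `b = a`. [folklore] -/
private theorem eq_of_add_eq_zero {M : Type*} [AddCommGroup M] [Module (ZMod 2) M] {a b : M}
    (h : a + b = 0) : b = a := by
  rw [eq_neg_of_add_eq_zero_right h]
  exact neg_eq_of_add_eq_zero_left (ZModModule.add_self a)

/-- **The distance count.** If `ψ` is injective on `C'/C` without nonzero fixed points there,
`wt(C ∖ 0) ≥ d` and `wt(C' ∖ 0) ≥ d'`, then every nonzero `(u|v) ∈ 𝒢` has
`wt(u|v) ≥ min(d, ⌈3d'/2⌉)`: either `wt u ≥ d` or `wt v ≥ d`, or else `u ∉ C` (so `[u] ≠ 0`),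
`v ∉ C` (injectivity), `u + v ∉ C` (no fixed point), whence `wt u, wt v, wt(u+v) ≥ d'` and
`2·wt(u|v) ≥ 3d'`. [cite: Steane1999, §2 Thm. 1 proof (chunk p0004: "These are sufficient to imply that wt(u|v) ≥ 3d'/2")] -/
theorem le_sympWeight_of_mem_steaneSpace {d d' : ℕ}
    (hinj : ∀ x ∈ C'.map C.mkQ, ψ x = 0 → x = 0) (hfpf : ∀ x ∈ C'.map C.mkQ, ψ x = x → x = 0)
    (hd : ∀ c ∈ C, c ≠ 0 → d ≤ hammingNorm c) (hd' : ∀ c ∈ C', c ≠ 0 → d' ≤ hammingNorm c)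
    {w : SympVec n} (hw : w ∈ steaneSpace C C' ψ) (hw0 : w ≠ 0) :
    min d ((3 * d' + 1) / 2) ≤ sympWeight w := by
  obtain ⟨hu, hv, huv⟩ := hw
  by_cases h1 : d ≤ hammingNorm w.1
  · exact (min_le_left _ _).trans (h1.trans (hammingNorm_fst_le_sympWeight w))
  by_cases h2 : d ≤ hammingNorm w.2
  · exact (min_le_left _ _).trans (h2.trans (hammingNorm_snd_le_sympWeight w))
  -- both halves have weight `< d`, so neither is a nonzero word of `C`
  have hu0 : w.1 ∉ C := by
    intro h
    have hw2C : w.2 ∈ C := mem_of_mkQ_eq_zero (by rw [huv, mkQ_eq_zero_of_mem h, map_zero])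
    by_cases h10 : w.1 = 0
    · exact h2 (hd _ hw2C fun h20 => hw0 (Prod.ext h10 h20))
    · exact h1 (hd _ h h10)
  have hx : C.mkQ w.1 ∈ C'.map C.mkQ := Submodule.mem_map.2 ⟨w.1, hu, rfl⟩
  have hx0 : C.mkQ w.1 ≠ 0 := fun h => hu0 (mem_of_mkQ_eq_zero h)
  have hv0 : w.2 ∉ C := fun h => hx0 (hinj _ hx (by rw [← huv, mkQ_eq_zero_of_mem h]))
  have hs0 : w.1 + w.2 ∉ C := by
    intro h
    refine hx0 (hfpf _ hx ?_)
    rw [← huv]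
    have hsum : C.mkQ w.1 + C.mkQ w.2 = 0 := by rw [← map_add]; exact mkQ_eq_zero_of_mem h
    exact eq_of_add_eq_zero hsum
  have hwu : d' ≤ hammingNorm w.1 := hd' _ hu fun h => hu0 (h ▸ C.zero_mem)
  have hwv : d' ≤ hammingNorm w.2 := hd' _ hv fun h => hv0 (h ▸ C.zero_mem)
  have hws : d' ≤ hammingNorm (w.1 + w.2) := hd' _ (C'.add_mem hu hv) fun h => hs0 (h ▸ C.zero_mem)
  have h2w := two_mul_sympWeight w
  refine (min_le_right _ _).trans ?_
  omega

/-! ### 5. Steane's fixed-point-free map `A` -/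

/-- **Existence of `A`** ("We choose the map `A` such that `u = v` never occurs (a fixed point free
map). This can be achieved as long as `D` has more than one row"): if `dim C' ≥ dim C + 2` there is
a linear map `ψ` of `𝔽₂ⁿ/C` preserving `C'/C`, injective on it and without nonzero fixed points on
it. (Steane gives an explicit matrix; here `ψ` is multiplication by an `α ∉ {0, 1}` of `GF(2^m)`,
`m = dim C' − dim C ≥ 2`, transported to `C'/C` and extended by `0` on a complement.)
[cite: Steane1999, §2 Thm. 1 proof (chunk p0004: "This can be achieved as long as D has more than one row, by, for example, the map A = …")] -/
theorem exists_steaneMap (C C' : Submodule (ZMod 2) (Fin n → ZMod 2)) (hCC' : C ≤ C')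
    (hdim : finrank (ZMod 2) C + 2 ≤ finrank (ZMod 2) C') :
    ∃ ψ : ((Fin n → ZMod 2) ⧸ C) →ₗ[ZMod 2] ((Fin n → ZMod 2) ⧸ C),
      (∀ x ∈ C'.map C.mkQ, ψ x ∈ C'.map C.mkQ) ∧ (∀ x ∈ C'.map C.mkQ, ψ x = 0 → x = 0) ∧
      (∀ x ∈ C'.map C.mkQ, ψ x = x → x = 0) := by
  haveI : Fact (Nat.Prime 2) := ⟨Nat.prime_two⟩
  obtain ⟨m, hm⟩ : ∃ m, finrank (ZMod 2) C' = finrank (ZMod 2) C + m :=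
    Nat.exists_eq_add_of_le (by omega)
  have hm2 : 2 ≤ m := by omega
  have hm0 : m ≠ 0 := by omega
  -- `W = C'/C ≤ 𝔽₂ⁿ/C` has dimension `m`
  have hrange : LinearMap.range (C.mkQ.domRestrict C') = C'.map C.mkQ := by
    ext x
    simp only [LinearMap.mem_range, LinearMap.domRestrict_apply, Submodule.mem_map]
    constructor
    · rintro ⟨⟨y, hy⟩, rfl⟩
      exact ⟨y, hy, rfl⟩
    · rintro ⟨y, hy, rfl⟩
      exact ⟨⟨y, hy⟩, rfl⟩
  have hker : finrank (ZMod 2) (LinearMap.ker (C.mkQ.domRestrict C')) = finrank (ZMod 2) C := by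
    rw [LinearMap.ker_domRestrict, Submodule.ker_mkQ]
    exact (Submodule.comapSubtypeEquivOfLe hCC').finrank_eq
  have hW : finrank (ZMod 2) (C'.map C.mkQ) = m := by
    have h1 := LinearMap.finrank_range_add_finrank_ker (C.mkQ.domRestrict C')
    rw [hrange, hker] at h1
    omega
  -- transport to `GF(2^m)` and pick `α ∉ {0, 1}`
  obtain ⟨e⟩ : Nonempty ((C'.map C.mkQ) ≃ₗ[ZMod 2] GaloisField 2 m) :=
    ⟨LinearEquiv.ofFinrankEq _ _ (by rw [hW, GaloisField.finrank 2 hm0])⟩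
  obtain ⟨α, hα0, hα1⟩ : ∃ α : GaloisField 2 m, α ≠ 0 ∧ α ≠ 1 := by
    by_contra hno
    push Not at hno
    have hsurj : Function.Surjective (fun b : Bool => if b then (1 : GaloisField 2 m) else 0) := by
      intro a
      by_cases h : a = 0
      · exact ⟨false, by simp [h]⟩
      · exact ⟨true, by simp [hno a h]⟩
    have hle := Nat.card_le_card_of_surjective _ hsurj
    rw [GaloisField.card 2 m hm0, Nat.card_eq_fintype_card, Fintype.card_bool] at hle
    have : 2 ^ 2 ≤ 2 ^ m := Nat.pow_le_pow_right (by norm_num) hm2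
    omega
  -- `ψ₀ = e⁻¹ ∘ (α · ) ∘ e` on `W`, a projection `P` onto `W`, and `ψ = ι ∘ ψ₀ ∘ P`
  obtain ⟨ψ₀, hψ₀⟩ : ∃ ψ₀ : (C'.map C.mkQ) →ₗ[ZMod 2] (C'.map C.mkQ), ∀ y, e (ψ₀ y) = α * e y :=
    ⟨e.symm.toLinearMap ∘ₗ LinearMap.mulLeft (ZMod 2) α ∘ₗ e.toLinearMap, fun y => by simp⟩
  obtain ⟨Q, hWQ⟩ := Submodule.exists_isCompl (C'.map C.mkQ)
  obtain ⟨P, hP⟩ : ∃ P : ((Fin n → ZMod 2) ⧸ C) →ₗ[ZMod 2] (C'.map C.mkQ), ∀ y : C'.map C.mkQ,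
      P y = y :=
    ⟨Submodule.projectionOnto _ Q hWQ, fun y => by simp⟩
  refine ⟨(C'.map C.mkQ).subtype ∘ₗ ψ₀ ∘ₗ P, fun x _ => ?_, fun x hx h0 => ?_, fun x hx hfix => ?_⟩
  · simp only [LinearMap.comp_apply, Submodule.subtype_apply]
    exact (ψ₀ (P x)).2
  · have hPx : P x = ⟨x, hx⟩ := hP ⟨x, hx⟩
    have h1 : ψ₀ ⟨x, hx⟩ = 0 := by
      rw [LinearMap.comp_apply, LinearMap.comp_apply, hPx, Submodule.subtype_apply] at h0
      exact_mod_cast h0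
    have h2 : α * e ⟨x, hx⟩ = 0 := by rw [← hψ₀, h1, map_zero]
    have h3 : e ⟨x, hx⟩ = 0 := (mul_eq_zero.1 h2).resolve_left hα0
    have h4 : (⟨x, hx⟩ : C'.map C.mkQ) = 0 := e.map_eq_zero_iff.1 h3
    simpa using congrArg Subtype.val h4
  · have hPx : P x = ⟨x, hx⟩ := hP ⟨x, hx⟩
    have h1 : ψ₀ ⟨x, hx⟩ = ⟨x, hx⟩ := by
      rw [LinearMap.comp_apply, LinearMap.comp_apply, hPx, Submodule.subtype_apply] at hfix
      exact Subtype.ext hfix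
    have h2 : (α - 1) * e ⟨x, hx⟩ = 0 := by rw [sub_mul, one_mul, ← hψ₀, h1, sub_self]
    have h3 : e ⟨x, hx⟩ = 0 := (mul_eq_zero.1 h2).resolve_left (sub_ne_zero.2 hα1)
    have h4 : (⟨x, hx⟩ : C'.map C.mkQ) = 0 := e.map_eq_zero_iff.1 h3
    simpa using congrArg Subtype.val h4

/-! ### 6. Theorem 1 -/

/-- **Steane's enlargement theorem (Theorem 1 of [Steane1999]).** Let `C ≤ 𝔽₂ⁿ` be a binary linear
code of dimension `k` containing its dual (`C⊥ ≤ C`) all of whose nonzero words have weight `≥ d`,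
and let `C ≤ C' ≤ 𝔽₂ⁿ` be an enlargement of dimension `k' ≥ k + 2` all of whose nonzero words have
weight `≥ d'`. Then a PURE `[[n, k + k' − n, min(d, ⌈3d'/2⌉)]]` additive (stabilizer) code exists —
namely `S̄ = 𝒢⊥` for Steane's generator space `𝒢` (here `⌈3d'/2⌉ = (3d' + 1)/2`).
[cite: Steane1999, §2 Thm. 1 (arXiv:quant-ph/9802061 chunk p0004: "a pure quantum code of parameters [[n, k+k'−n, min(d, ⌈3d'/2⌉)]] can be constructed")] -/
theorem Steane1999_theorem1 {n k k' d d' : ℕ} (C C' : Submodule (ZMod 2) (Fin n → ZMod 2))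
    (hdual : dualCode C ≤ C) (hCC' : C ≤ C') (hk : finrank (ZMod 2) C = k)
    (hk' : finrank (ZMod 2) C' = k') (hkk' : k + 2 ≤ k')
    (hd : ∀ c ∈ C, c ≠ 0 → d ≤ hammingNorm c) (hd' : ∀ c ∈ C', c ≠ 0 → d' ≤ hammingNorm c) :
    PureAdditiveCodeExists n (k + k' - n) (min d ((3 * d' + 1) / 2)) := by
  obtain ⟨ψ, hW, hinj, hfpf⟩ := exists_steaneMap C C' hCC' (by omega)
  -- bookkeeping: `n ≤ 2k` (from `C⊥ ≤ C`), `k' ≤ n`, `dim 𝒢 = k + k'`, `dim 𝒢⊥ + dim 𝒢 = 2n`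
  have hn2k : n ≤ 2 * k := by
    have h1 := Submodule.finrank_mono hdual
    rw [finrank_dualCode, Fintype.card_fin, hk] at h1
    omega
  have hk'n : k' ≤ n := by
    have h1 := Submodule.finrank_le C'
    rw [Module.finrank_fintype_fun_eq_card, Fintype.card_fin, hk'] at h1
    exact h1
  have hG := finrank_steaneSpace hCC' hW
  rw [hk, hk'] at hG
  have hS := finrank_sympDual_add (steaneSpace C C' ψ)
  have hle : sympDual (steaneSpace C C' ψ) ≤ steaneSpace C C' ψ := sympDual_steaneSpace_le hdual hCC'
  have hwt : ∀ w ∈ steaneSpace C C' ψ, w ≠ 0 → min d ((3 * d' + 1) / 2) ≤ sympWeight w :=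
    fun w hw hw0 => le_sympWeight_of_mem_steaneSpace hinj hfpf hd hd' hw hw0
  refine ⟨sympDual (steaneSpace C C' ψ), ⟨?_, by omega, ?_, ?_⟩, ?_⟩
  · -- self-orthogonal: `𝒢⊥ ≤ 𝒢 = 𝒢⊥⊥`
    intro w hw
    rw [sympDual_sympDual]
    exact hle hw
  · intro w hw hwS
    rw [sympDual_sympDual] at hw
    exact hwt w hw fun h0 => hwS (h0 ▸ Submodule.zero_mem _)
  · intro _ v hv hv0
    exact hwt v (hle hv) hv0
  · intro w hw hw0
    rw [sympDual_sympDual] at hw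
    exact hwt w hw hw0

/-- **Theorem 1, non-pure reading**: in particular an `[[n, k + k' − n, min(d, ⌈3d'/2⌉)]]` additive
code exists. [cite: Steane1999, §2 Thm. 1 (chunk p0004)] -/
theorem Steane1999_theorem1_additiveCodeExists {n k k' d d' : ℕ}
    (C C' : Submodule (ZMod 2) (Fin n → ZMod 2))
    (hdual : dualCode C ≤ C) (hCC' : C ≤ C') (hk : finrank (ZMod 2) C = k)
    (hk' : finrank (ZMod 2) C' = k') (hkk' : k + 2 ≤ k')
    (hd : ∀ c ∈ C, c ≠ 0 → d ≤ hammingNorm c) (hd' : ∀ c ∈ C', c ≠ 0 → d' ≤ hammingNorm c) :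
    AdditiveCodeExists n (k + k' - n) (min d ((3 * d' + 1) / 2)) := by
  obtain ⟨S, hS, -⟩ := Steane1999_theorem1 C C' hdual hCC' hk hk' hkk' hd hd'
  exact ⟨S, hS⟩

end Literature.InformationTheory.QuantumCodes
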